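import Literature.NumberTheory.Sieve.HeathBrownCubicGrossen
import Mathlib.RingTheory.RootsOfUnity.Complex
import HarnessLib

/-!
# Trivial characters `ν^{(j,k)}` are exactly `χ = χ₀`, `j = k = 0`

Sequel of `HeathBrownCubicGrossen` (Heath-Brown's Grössencharaktere (9.2) of `ℤ[2^{1/3}]`,
`grossenChar hq χ j k = ν₀ν₁^jν₂^k` on ideals, and the printed notion `IsTrivialMod q ν`: "the
character `ν(S)` is trivial if it takes the value `1` whenever `S` is coprime to `q`"). Heath-Brown
asserts (*Primes represented by `x³ + 2y³`*, Acta Math. 186 (2001), p. 54; Harman, *Prime-Detecting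
Sieves*, p. 274): "This corresponds to having the trivial character `χ` modulo `q`, letting `s = t = 0`
in the definition of `ν₀`, and taking `j = k = 0`." The easy direction is
`isTrivialMod_grossenChar_one` there; this file PROVES the converse, which the evaluation of `E(𝐱)`
(Lemma 9.3: a main term exactly for the trivial character) needs:

* `eq_one_of_isTrivialMod : IsTrivialMod q (grossenChar hq χ j k) → χ = 1 ∧ j = 0 ∧ k = 0`, with
  `charSign_eq_zero_of_isTrivialMod` (`s = 0`), `charAngle_eq_zero_of_isTrivialMod` (`t = 0`), and
  `isTrivialMod_iff`.

The printed sentence carries no proof; ours tests `ν` on elements `β ≡ 1 (mod q)` (where `χ(β) = 1`):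
(1) `β = 1 + qm ∈ ℕ`: the value is `exp(−iv⁻¹log β·(t + ju + 2πk))` (`nuO_rational`), so
`w = t + ju + 2πk` has `(log(1+qm)/v)·w ∈ 2πℤ` for all `m`; consecutive differences are integer
multiples of `2π` of size `≤ |w|q/((1+qm)v) → 0`, hence `0`, forcing `w = 0`
(`charAngle_add_eq_zero_of_isTrivialMod`); (2) `β = 1 + qmθ`: the value is `(z_m/|z_m|)^j`,
`z_m = 1 + qmρω = β'` (`nuO_theta`), and the directions `z_m/|z_m|` are pairwise distinct
(`zTest_div_norm_injective`), so they cannot all be `|j|`-th roots of unity unless `j = 0`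
(`eq_zero_of_isTrivialMod_j`, pigeonhole `not_injective_infinite_finite`); (3) then `t + 2πk = 0` with
`|t| ≤ π` gives `k = 0`, `t = 0`; (4) `β = 1 − qθ < 0`: the value is `(−1)^s` (`nuO_theta_neg`), so
`s = 0`, i.e. `χ(−1) = 1`; (5) every unit `a` of `𝓞_K/(q)` lifts to some `γ ≠ 0`, and the value at
`(γ)` is then `χ(a)`, so `χ = χ₀` (`MulChar.ext`).

## References

* D. R. Heath-Brown, *Primes represented by `x³ + 2y³`*, Acta Math. 186 (2001), §9 p. 54.
  [cite: HeathBrownActa2001, §9 p. 54]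
* G. Harman, *Prime-Detecting Sieves*, LMS Monographs 33 (2007), §13.6 p. 274. [cite: Harman2007, §13.6]

## Mathlib / tree search

Tree: `HeathBrownCubicGrossen` (all the `ν`-algebra), `HeathBrownCubicWindow` (`rho`, `one_lt_rho`, `ell`,
`coordElt_injective`), `HeathBrownCubicPolar` (`cplxEmb_re/im`). Mathlib: `Complex.exp_eq_one_iff`,
`Real.log_le_sub_one_of_pos`, `Int.abs_lt_one_iff`, `Polynomial.mem_nthRootsFinset`,
`not_injective_infinite_finite`, `MulChar.ext`, `Ideal.Quotient.mk_surjective`.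
-/

noncomputable section

open Polynomial NumberField Finset Complex

namespace Literature.NumberTheory.Sieve.CubicSieve

open LFunctions.CubeRootTwoField CubicPrimes

variable {q : ℕ}

/-! ### Test elements `β ≡ 1 (mod q)` -/

/-- For `β ≡ 1 (mod q)`, `β ≠ 0`, a trivial `ν^{(j,k)}` has `ν₀(β)ν₁(β)^jν₂(β)^k = 1`. [cite: HeathBrownActa2001, §9 p. 54] -/
theorem nuO_eq_one_of_isTrivialMod (hq : 1 ≤ q) {χ : MulChar (QuotMod q) ℂ} {j k : ℤ}
    (h : IsTrivialMod q (grossenChar hq χ j k)) {β : 𝓞 K} (hβ : β ≠ 0) (h1 : IsUnit (toQuotMod q β)) :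
    nu0O χ β * nu1O β ^ j * nu2O β ^ k = 1 := by
  have hS : Ideal.span {β} ≠ ⊥ := by rwa [Ne, Ideal.span_singleton_eq_bot]
  have hcop : Ideal.span {β} ⊔ Ideal.span {((q : ℕ) : 𝓞 K)} = ⊤ := by
    rw [Ideal.sup_eq_top_iff_isCoprime, ← isUnit_toQuotMod_iff]; exact h1
  rw [← grossenChar_span hq χ j k hβ]
  exact h _ hS hcop

/-- `coordElt (a, b, 0) ≡ 1 (mod q)` when `a ≡ 1`, `b ≡ 0 (mod q)`: concretely for `a = 1 + qm`, `b = qn`.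
[folklore] -/
theorem toQuotMod_coordElt_eq_one (q : ℕ) (m n : ℤ) :
    toQuotMod q (coordElt (1 + q * m, q * n, 0)) = 1 := by
  have hq0 : toQuotMod q ((q : ℕ) : 𝓞 K) = 0 :=
    Ideal.Quotient.eq_zero_iff_mem.mpr (Ideal.mem_span_singleton_self _)
  simp only [coordElt, Int.cast_add, Int.cast_one, Int.cast_mul, Int.cast_natCast, Int.cast_zero,
    zero_mul, add_zero, map_add, map_one, map_mul, map_natCast]
  rw [show ((q : ℕ) : QuotMod q) = toQuotMod q ((q : ℕ) : 𝓞 K) from (map_natCast _ q).symm, hq0]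
  ring

/-- `coordElt (a, b, 0) ≠ 0` if `a ≠ 0`. [folklore] -/
theorem coordElt_ne_zero_of_fst_ne_zero {a b c : ℤ} (ha : a ≠ 0) : coordElt (a, b, c) ≠ 0 := by
  intro h
  have := congrArg coordVec h
  rw [coordVec_coordElt, coordVec_zero'] at this
  exact ha (congrArg Prod.fst this)

/-! ### Values on the test elements -/

/-- `cplxEmb (a, 0, 0) = a`. [folklore] -/
theorem cplxEmb_real (a : ℝ) : cplxEmb (a, (0 : ℝ), (0 : ℝ)) = (a : ℂ) := by
  apply Complex.ext <;> simp

/-- `ν₂(a, b, c)` in terms of `β = ell`: by definition. [folklore] -/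
theorem nu2_eq (p : ℝ × ℝ × ℝ) :
    nu2 p = Complex.exp ((-(2 * Real.pi * (Real.log |ell p| / unitLog)) : ℝ) * Complex.I) := rfl

/-- **`ν₁` at a positive rational vector**: `ν₁(a, 0, 0) = exp(−iu v⁻¹ log a)` for `a > 0`. [folklore] -/
theorem nu1_real {a : ℝ} (ha : 0 < a) :
    nu1 (a, (0 : ℝ), (0 : ℝ)) = Complex.exp ((-(unitArg * (Real.log a / unitLog)) : ℝ) * Complex.I) := by
  have hell : ell (a, (0 : ℝ), (0 : ℝ)) = a := by simp [ell]
  have ha2 : (a : ℂ) * (a : ℂ) ≠ 0 := mul_ne_zero (Complex.ofReal_ne_zero.mpr ha.ne') (Complex.ofReal_ne_zero.mpr ha.ne')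
  rw [nu1, hell, cplxEmb_real, abs_of_pos ha]
  have : (‖(a : ℂ) * (a : ℂ)‖ : ℂ) = (a : ℂ) * a := by
    rw [norm_mul, Complex.norm_real, Real.norm_eq_abs, abs_of_pos ha]; push_cast; ring
  rw [this, div_self ha2, one_mul]

/-- **`ν₀` at `β ≡ 1 (mod q)` with `β > 0`**: `ν₀(β) = exp(−it v⁻¹ log β)`. [folklore] -/
theorem nu0O_of_toQuotMod_eq_one (χ : MulChar (QuotMod q) ℂ) {β : 𝓞 K} (h1 : toQuotMod q β = 1)
    (hpos : 0 < ellO β) :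
    nu0O χ β = Complex.exp ((-(charAngle χ * (Real.log (ellO β) / unitLog)) : ℝ) * Complex.I) := by
  rw [nu0O, h1, MulChar.map_one, one_mul, abs_of_pos hpos, div_self hpos.ne', Complex.ofReal_one, one_pow,
    one_mul]

/-- **`ν₀` at `β ≡ 1 (mod q)` with `β < 0`**: `ν₀(β) = (−1)^s exp(−it v⁻¹ log|β|)`. [folklore] -/
theorem nu0O_of_toQuotMod_eq_one_of_neg (χ : MulChar (QuotMod q) ℂ) {β : 𝓞 K} (h1 : toQuotMod q β = 1)
    (hneg : ellO β < 0) :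
    nu0O χ β = (-1) ^ charSign χ *
      Complex.exp ((-(charAngle χ * (Real.log |ellO β| / unitLog)) : ℝ) * Complex.I) := by
  rw [nu0O, h1, MulChar.map_one, one_mul, abs_of_neg hneg, div_neg, div_self hneg.ne, Complex.ofReal_neg,
    Complex.ofReal_one]

/-- Powers of `exp(iθ)`: `exp(θ I)^j = exp(jθ I)` for `j ∈ ℤ`. [folklore] -/
theorem exp_ofReal_mul_I_zpow (θ : ℝ) (j : ℤ) :
    Complex.exp ((θ : ℂ) * Complex.I) ^ j = Complex.exp (((j * θ : ℝ)) * Complex.I) := by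
  rw [← Complex.exp_int_mul]; congr 1; push_cast; ring

/-- **The product `ν₀ν₁^jν₂^k` at the rational test elements `β = 1 + qm > 0`**:
`= exp(−i v⁻¹ log β · (t + ju + 2πk))`. [cite: HeathBrownActa2001, §9 p. 54] -/
theorem nuO_rational (χ : MulChar (QuotMod q) ℂ) (j k : ℤ) (m : ℕ) :
    let β : 𝓞 K := coordElt (1 + q * m, q * 0, 0)
    nu0O χ β * nu1O β ^ j * nu2O β ^ k =
      Complex.exp ((-(Real.log (1 + q * m) / unitLog * (charAngle χ + j * unitArg + 2 * Real.pi * k)) : ℝ) *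
        Complex.I) := by
  intro β
  have ha : (0 : ℝ) < 1 + q * m := by positivity
  have hvec : realVec β = ((1 + q * m : ℝ), (0 : ℝ), (0 : ℝ)) := by
    simp [β, castVec]
  have hell : ellO β = 1 + q * m := by
    rw [← ell_realVec, hvec]; simp [ell]
  rw [nu0O_of_toQuotMod_eq_one χ (toQuotMod_coordElt_eq_one q m 0) (by rw [hell]; exact ha), hell,
    nu1O, nu2O, hvec, nu1_real ha, nu2_eq, show ell ((1 + q * m : ℝ), (0 : ℝ), (0 : ℝ)) = 1 + q * m by simp [ell],
    abs_of_pos ha, exp_ofReal_mul_I_zpow, exp_ofReal_mul_I_zpow, ← Complex.exp_add, ← Complex.exp_add]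
  congr 1
  push_cast
  ring

/-! ### Step 1: `t + ju + 2πk = 0` -/

/-- **Step 1.** If `ν^{(j,k)}` is trivial then `w = t + ju + 2πk = 0`: the values at `β = 1 + qm` give
`(log(1 + qm)/v)·w ∈ 2πℤ` for all `m`, and consecutive differences `(w/v) log((1+q(m+1))/(1+qm))` are
integer multiples of `2π` tending to `0`, hence eventually `0`, forcing `w = 0`. [cite: HeathBrownActa2001, §9 p. 54] -/
theorem charAngle_add_eq_zero_of_isTrivialMod (hq : 1 ≤ q) {χ : MulChar (QuotMod q) ℂ} {j k : ℤ}
    (h : IsTrivialMod q (grossenChar hq χ j k)) :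
    charAngle χ + j * unitArg + 2 * Real.pi * k = 0 := by
  set w : ℝ := charAngle χ + j * unitArg + 2 * Real.pi * k with hw
  have hv := unitLog_pos
  have hπ := Real.pi_pos
  -- the integer multiples
  have key : ∀ m : ℕ, ∃ n : ℤ, Real.log (1 + q * m) / unitLog * w = 2 * Real.pi * n := by
    intro m
    have h1 := nuO_eq_one_of_isTrivialMod hq h
      (coordElt_ne_zero_of_fst_ne_zero (a := 1 + q * m) (b := q * 0) (c := 0) (by positivity))
      (by rw [toQuotMod_coordElt_eq_one]; exact isUnit_one)
    have h2 := nuO_rational χ j k m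
    simp only at h2
    rw [h1] at h2
    obtain ⟨n, hn⟩ := Complex.exp_eq_one_iff.mp h2.symm
    refine ⟨-n, ?_⟩
    have := congrArg Complex.im hn
    simp at this
    push_cast
    linarith
  choose n hn using key
  by_contra hw0
  -- a large `M`
  obtain ⟨M, hM⟩ := exists_nat_gt (|w| * q / (2 * Real.pi * unitLog))
  have hM0 : (0 : ℝ) < 1 + q * M := by positivity
  have hM1 : (0 : ℝ) < 1 + q * (M + 1 : ℕ) := by positivity
  -- the difference of consecutive relations
  have hdiff : (Real.log (1 + q * (M + 1 : ℕ)) - Real.log (1 + q * M)) / unitLog * w =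
      2 * Real.pi * (n (M + 1) - n M) := by
    have := hn (M + 1); have := hn M; push_cast at *; 
    field_simp
    rw [div_mul_eq_mul_div, div_eq_iff hv.ne'] at *
    linarith
  have hlogpos : 0 < Real.log (1 + q * (M + 1 : ℕ)) - Real.log (1 + q * M) := by
    rw [sub_pos]; apply Real.log_lt_log hM0; push_cast
    have : (0 : ℝ) < q := by exact_mod_cast hq
    linarith
  have hlogle : Real.log (1 + q * (M + 1 : ℕ)) - Real.log (1 + q * M) ≤ q / (1 + q * M) := by
    rw [← Real.log_div hM1.ne' hM0.ne']
    refine (Real.log_le_sub_one_of_pos (div_pos hM1 hM0)).trans (le_of_eq ?_)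
    field_simp; push_cast; ring
  -- `|n(M+1) − n(M)| < 1`
  have hlt : |((n (M + 1) - n M : ℤ) : ℝ)| < 1 := by
    have h1 : |2 * Real.pi * ((n (M + 1) - n M : ℤ) : ℝ)| ≤ q / (1 + q * M) / unitLog * |w| := by
      push_cast
      rw [← hdiff, abs_mul, abs_div, abs_of_pos hlogpos, abs_of_pos hv]
      gcongr
    have h2 : q / (1 + q * M) / unitLog * |w| < 2 * Real.pi := by
      rw [div_lt_iff₀ (by positivity)] at hM
      rw [div_div, div_mul_eq_mul_div, div_lt_iff₀ (by positivity)]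
      have hqM : (M : ℝ) ≤ 1 + q * M := by
        have : (1 : ℝ) ≤ q := by exact_mod_cast hq
        nlinarith
      have h2πv : 0 < 2 * Real.pi * unitLog := by positivity
      calc (q : ℝ) * |w| = |w| * q := mul_comm _ _
        _ < M * (2 * Real.pi * unitLog) := hM
        _ ≤ (1 + q * M) * (2 * Real.pi * unitLog) := by gcongr
        _ = 2 * Real.pi * ((1 + q * M) * unitLog) := by ring
    rw [abs_mul, abs_of_pos (by positivity : (0 : ℝ) < 2 * Real.pi)] at h1
    nlinarith [abs_nonneg (((n (M + 1) - n M : ℤ) : ℝ))]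
  have heq : n (M + 1) - n M = 0 := by
    have : |n (M + 1) - n M| < 1 := by exact_mod_cast hlt
    exact Int.abs_lt_one_iff.mp this
  have heq' : ((n (M + 1) : ℝ) - n M) = 0 := by exact_mod_cast heq
  rw [heq', mul_zero, mul_eq_zero, div_eq_zero_iff] at hdiff
  rcases hdiff with (h0 | h0) | h0
  · linarith
  · exact hv.ne' h0
  · exact hw0 h0

/-! ### Step 2: `j = 0` -/

/-- The complex embeddings of the test elements `1 + qmθ`: `z_m = 1 + qmρω`. [folklore] -/
def zTest (q m : ℕ) : ℂ := cplxEmb ((1 : ℝ), ((q * m : ℕ) : ℝ), (0 : ℝ))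

/-- `Im z_m = (√3/2)ρqm > 0` for `m ≥ 1` (`q ≥ 1`). [folklore] -/
theorem zTest_im_pos (hq : 1 ≤ q) {m : ℕ} (hm : 1 ≤ m) : 0 < (zTest q m).im := by
  rw [zTest, cplxEmb_im]
  have : (0 : ℝ) < (q * m : ℕ) := by exact_mod_cast Nat.mul_pos hq hm
  have := rho_pos
  have : (0 : ℝ) < Real.sqrt 3 := by positivity
  simp only [mul_zero, sub_zero]
  positivity

/-- `Re z_m = 1 − ρqm/2`. [folklore] -/
theorem zTest_re (q m : ℕ) : (zTest q m).re = 1 - rho * ((q * m : ℕ) : ℝ) / 2 := by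
  rw [zTest, cplxEmb_re]; ring

/-- `Im z_m = (√3/2)ρqm`. [folklore] -/
theorem zTest_im (q m : ℕ) : (zTest q m).im = Real.sqrt 3 / 2 * (rho * ((q * m : ℕ) : ℝ)) := by
  rw [zTest, cplxEmb_im]; ring

/-- `z_m ≠ 0` for `m ≥ 1`. [folklore] -/
theorem zTest_ne_zero (hq : 1 ≤ q) {m : ℕ} (hm : 1 ≤ m) : zTest q m ≠ 0 := fun h => by
  have := zTest_im_pos hq hm; rw [h, Complex.zero_im] at this; exact lt_irrefl _ this

/-- **The directions `z_m/|z_m|` are pairwise distinct** (`z_m‖z_n‖ = z_n‖z_m‖` forces `‖z_m‖ = ‖z_n‖` from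
the imaginary and real parts, then `m = n`). [folklore] -/
theorem zTest_div_norm_injective (hq : 1 ≤ q) {m n : ℕ} (hm : 1 ≤ m) (hn : 1 ≤ n)
    (h : zTest q m / (‖zTest q m‖ : ℂ) = zTest q n / (‖zTest q n‖ : ℂ)) : m = n := by
  have hzm := zTest_ne_zero hq hm
  have hzn := zTest_ne_zero hq hn
  have hNm : (0 : ℝ) < ‖zTest q m‖ := norm_pos_iff.mpr hzm
  have hNn : (0 : ℝ) < ‖zTest q n‖ := norm_pos_iff.mpr hzn
  rw [div_eq_div_iff (Complex.ofReal_ne_zero.mpr hNm.ne') (Complex.ofReal_ne_zero.mpr hNn.ne')] at h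
  have hre := congrArg Complex.re h
  have him := congrArg Complex.im h
  simp only [Complex.mul_re, Complex.mul_im, Complex.ofReal_re, Complex.ofReal_im, mul_zero, sub_zero,
    zTest_re, zTest_im] at hre him
  have hρ := rho_pos
  have hs : (0 : ℝ) < Real.sqrt 3 := by positivity
  -- from the imaginary parts: `m ‖z_n‖ = n ‖z_m‖`
  have h1 : ((q * m : ℕ) : ℝ) * ‖zTest q n‖ = ((q * n : ℕ) : ℝ) * ‖zTest q m‖ := by
    have hc : (0 : ℝ) < Real.sqrt 3 / 2 * rho := by positivity
    nlinarith [him, hc]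
  -- from the real parts: `‖z_n‖ = ‖z_m‖`
  have h2 : ‖zTest q n‖ = ‖zTest q m‖ := by linear_combination hre + (rho / 2) * h1
  rw [h2] at h1
  have h3 : ((q * m : ℕ) : ℝ) = ((q * n : ℕ) : ℝ) := by
    have := mul_right_cancel₀ hNm.ne' h1; exact this
  have h4 : q * m = q * n := by exact_mod_cast h3
  exact Nat.eq_of_mul_eq_mul_left hq h4

/-- **The product `ν₀ν₁^jν₂^k` at `β = 1 + qmθ`** (`m ≥ 1`, `β ≡ 1 (mod q)`, `β > 0`):
`= (z_m/|z_m|)^j exp(−i v⁻¹ log β · (t + ju + 2πk))`. [cite: HeathBrownActa2001, §9 p. 54] -/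
theorem nuO_theta (χ : MulChar (QuotMod q) ℂ) (j k : ℤ) (m : ℕ) :
    let β : 𝓞 K := coordElt (1 + q * 0, q * m, 0)
    nu0O χ β * nu1O β ^ j * nu2O β ^ k =
      (zTest q m / (‖zTest q m‖ : ℂ)) ^ j *
        Complex.exp ((-(Real.log (1 + rho * (q * m : ℕ)) / unitLog * (charAngle χ + j * unitArg + 2 * Real.pi * k)) : ℝ) *
          Complex.I) := by
  intro β
  have hqm : (0 : ℝ) ≤ (q * m : ℕ) := by positivity
  have ha : (0 : ℝ) < 1 + rho * (q * m : ℕ) := by have := rho_pos; positivity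
  have hvec : realVec β = ((1 : ℝ), ((q * m : ℕ) : ℝ), (0 : ℝ)) := by
    simp [β, castVec]
  have hellv : ell ((1 : ℝ), ((q * m : ℕ) : ℝ), (0 : ℝ)) = 1 + rho * (q * m : ℕ) := by simp [ell]
  have hell : ellO β = 1 + rho * (q * m : ℕ) := by rw [← ell_realVec, hvec, hellv]
  rw [nu0O_of_toQuotMod_eq_one χ (toQuotMod_coordElt_eq_one q 0 m) (by rw [hell]; exact ha), hell,
    nu1O, nu2O, hvec, nu2_eq, hellv, abs_of_pos ha, nu1, hellv, abs_of_pos ha]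
  rw [show cplxEmb ((1 : ℝ), ((q * m : ℕ) : ℝ), (0 : ℝ)) = zTest q m from rfl]
  have hsimp : ((1 + rho * (q * m : ℕ) : ℝ) : ℂ) * zTest q m / (‖((1 + rho * (q * m : ℕ) : ℝ) : ℂ) * zTest q m‖ : ℂ) =
      zTest q m / (‖zTest q m‖ : ℂ) := by
    rw [norm_mul, Complex.norm_real, Real.norm_eq_abs, abs_of_pos ha, Complex.ofReal_mul,
      mul_div_mul_left _ _ (Complex.ofReal_ne_zero.mpr ha.ne')]
  rw [hsimp, mul_zpow, exp_ofReal_mul_I_zpow, exp_ofReal_mul_I_zpow]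
  rw [show ∀ a b c d : ℂ, a * (b * c) * d = b * (a * c * d) from fun a b c d => by ring, ← Complex.exp_add,
    ← Complex.exp_add]
  congr 2
  push_cast
  ring

/-- **Step 2.** If `ν^{(j,k)}` is trivial then `j = 0`: by Step 1 the exponential factor is `1`, so
`(z_m/|z_m|)^j = 1` for all `m ≥ 1`; for `j ≠ 0` the directions `z_m/|z_m|` would all be `|j|`-th roots
of unity, a finite set, but they are pairwise distinct. [cite: HeathBrownActa2001, §9 p. 54] -/
theorem eq_zero_of_isTrivialMod_j (hq : 1 ≤ q) {χ : MulChar (QuotMod q) ℂ} {j k : ℤ}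
    (h : IsTrivialMod q (grossenChar hq χ j k)) : j = 0 := by
  have hw := charAngle_add_eq_zero_of_isTrivialMod hq h
  by_contra hj
  set N : ℕ := j.natAbs with hN
  have hN0 : 0 < N := Int.natAbs_pos.mpr hj
  -- `(z_m/|z_m|)^N = 1` for `m ≥ 1`
  have hroot : ∀ m : ℕ, 1 ≤ m → (zTest q m / (‖zTest q m‖ : ℂ)) ^ N = 1 := by
    intro m hm
    have h1 := nuO_eq_one_of_isTrivialMod hq h
      (coordElt_ne_zero_of_fst_ne_zero (a := 1 + q * 0) (b := q * m) (c := 0) (by simp))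
      (by rw [toQuotMod_coordElt_eq_one]; exact isUnit_one)
    have h2 := nuO_theta χ j k m
    simp only at h2
    rw [h1, hw, mul_zero, neg_zero, Complex.ofReal_zero, zero_mul, Complex.exp_zero, mul_one] at h2
    -- `w^j = 1` with `j = ±N`
    have hz : (zTest q m / (‖zTest q m‖ : ℂ)) ^ j = 1 := h2.symm
    rcases Int.natAbs_eq j with hj' | hj'
    · rw [hj', zpow_natCast] at hz; exact hz
    · rw [hj', zpow_neg, zpow_natCast, inv_eq_one] at hz; exact hz
  -- the injective map into the `N`-th roots of unity
  let f : ℕ → {x // x ∈ Polynomial.nthRootsFinset N (1 : ℂ)} := fun m =>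
    ⟨zTest q (m + 1) / (‖zTest q (m + 1)‖ : ℂ), (Polynomial.mem_nthRootsFinset hN0 (1 : ℂ)).mpr (hroot (m + 1) le_add_self)⟩
  have hf : Function.Injective f := by
    intro m n hmn
    have := congrArg (fun x => x.val) hmn
    simp only [f] at this
    have := zTest_div_norm_injective hq le_add_self le_add_self this
    omega
  exact not_injective_infinite_finite f hf

/-! ### Step 3: `k = 0` and `t = 0` -/

/-- **Step 3.** If `ν^{(j,k)}` is trivial then `k = 0` (`t + 2πk = 0` with `|t| ≤ π`). [cite: HeathBrownActa2001, §9 p. 54] -/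
theorem eq_zero_of_isTrivialMod_k (hq : 1 ≤ q) {χ : MulChar (QuotMod q) ℂ} {j k : ℤ}
    (h : IsTrivialMod q (grossenChar hq χ j k)) : k = 0 := by
  have hw := charAngle_add_eq_zero_of_isTrivialMod hq h
  rw [eq_zero_of_isTrivialMod_j hq h, Int.cast_zero, zero_mul, add_zero] at hw
  have ht := abs_charAngle_le χ
  by_contra hk
  have h1 : (1 : ℝ) ≤ |(k : ℝ)| := by exact_mod_cast Int.one_le_abs hk
  have h2 : |charAngle χ| = 2 * Real.pi * |(k : ℝ)| := by
    rw [show charAngle χ = -(2 * Real.pi * k) by linarith, abs_neg, abs_mul, abs_of_pos Real.two_pi_pos]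
  nlinarith [Real.pi_pos]

/-- If `ν^{(j,k)}` is trivial then `t = 0`. [cite: HeathBrownActa2001, §9 p. 54] -/
theorem charAngle_eq_zero_of_isTrivialMod (hq : 1 ≤ q) {χ : MulChar (QuotMod q) ℂ} {j k : ℤ}
    (h : IsTrivialMod q (grossenChar hq χ j k)) : charAngle χ = 0 := by
  have hw := charAngle_add_eq_zero_of_isTrivialMod hq h
  rw [eq_zero_of_isTrivialMod_j hq h, eq_zero_of_isTrivialMod_k hq h] at hw
  simpa using hw

/-! ### Step 4: `s = 0`, i.e. `χ(−1) = 1` -/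

/-- **The product `ν₀ν₁^0ν₂^k` at `β = 1 − qmθ < 0`** (`m ≥ 1`): `= (−1)^s exp(−i v⁻¹ log|β| (t + 2πk))`.
[cite: HeathBrownActa2001, §9 p. 54] -/
theorem nuO_theta_neg (hq : 1 ≤ q) (χ : MulChar (QuotMod q) ℂ) (k : ℤ) {m : ℕ} (hm : 1 ≤ m) :
    let β : 𝓞 K := coordElt (1 + q * 0, q * (-(m : ℤ)), 0)
    nu0O χ β * nu1O β ^ (0 : ℤ) * nu2O β ^ k =
      (-1) ^ charSign χ *
        Complex.exp ((-(Real.log |1 - rho * (q * m : ℕ)| / unitLog * (charAngle χ + 2 * Real.pi * k)) : ℝ) *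
          Complex.I) := by
  intro β
  have hqm : (1 : ℝ) ≤ (q * m : ℕ) := by exact_mod_cast Nat.mul_pos hq hm
  have hneg : 1 - rho * (q * m : ℕ) < (0 : ℝ) := by nlinarith [one_lt_rho]
  have hvec : realVec β = ((1 : ℝ), (-((q * m : ℕ) : ℝ)), (0 : ℝ)) := by
    simp [β, castVec]
  have hellv : ell ((1 : ℝ), (-((q * m : ℕ) : ℝ)), (0 : ℝ)) = 1 - rho * (q * m : ℕ) := by simp [ell]; ring
  have hell : ellO β = 1 - rho * (q * m : ℕ) := by rw [← ell_realVec, hvec, hellv]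
  rw [nu0O_of_toQuotMod_eq_one_of_neg χ (toQuotMod_coordElt_eq_one q 0 (-(m : ℤ))) (by rw [hell]; exact hneg),
    hell, zpow_zero, mul_one, nu2O, hvec, nu2_eq, hellv, exp_ofReal_mul_I_zpow, mul_assoc, ← Complex.exp_add]
  congr 2
  push_cast
  ring

/-- **Step 4.** If `ν^{(j,k)}` is trivial then `s = 0`: at `β = 1 − qθ < 0` the product is `(−1)^s`.
[cite: HeathBrownActa2001, §9 p. 54] -/
theorem charSign_eq_zero_of_isTrivialMod (hq : 1 ≤ q) {χ : MulChar (QuotMod q) ℂ} {j k : ℤ}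
    (h : IsTrivialMod q (grossenChar hq χ j k)) : charSign χ = 0 := by
  have hj := eq_zero_of_isTrivialMod_j hq h
  have hk := eq_zero_of_isTrivialMod_k hq h
  have ht := charAngle_eq_zero_of_isTrivialMod hq h
  subst hj; subst hk
  have h1 := nuO_eq_one_of_isTrivialMod hq h
    (coordElt_ne_zero_of_fst_ne_zero (a := 1 + q * 0) (b := q * (-(1 : ℤ))) (c := 0) (by simp))
    (by rw [show ((q : ℤ) * (-(1 : ℤ))) = q * (-((1 : ℕ) : ℤ)) by simp, toQuotMod_coordElt_eq_one]; exact isUnit_one)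
  have h2 := nuO_theta_neg hq χ 0 le_rfl
  simp only at h2
  rw [show ((q : ℤ) * (-((1 : ℕ) : ℤ))) = q * (-(1 : ℤ)) by simp] at h2
  rw [h1, ht, Int.cast_zero, mul_zero, add_zero, mul_zero, neg_zero, Complex.ofReal_zero, zero_mul,
    Complex.exp_zero, mul_one] at h2
  have hs := charSign_le_one χ
  interval_cases (charSign χ)
  · rfl
  · norm_num at h2

/-- If `ν^{(j,k)}` is trivial then `χ(−1) = 1`. [cite: HeathBrownActa2001, §9 p. 54] -/
theorem mulChar_neg_one_eq_one_of_isTrivialMod (hq : 1 ≤ q) {χ : MulChar (QuotMod q) ℂ} {j k : ℤ}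
    (h : IsTrivialMod q (grossenChar hq χ j k)) : χ (-1) = 1 := by
  rw [mulChar_neg_one_eq, charSign_eq_zero_of_isTrivialMod hq h, pow_zero]

/-! ### Step 5: `χ = χ₀`, and the characterisation of the trivial characters -/

/-- Every unit of `𝓞_K/(q)` lifts to a non-zero element of `𝓞_K`. [folklore] -/
theorem exists_ne_zero_toQuotMod_eq (hq : 1 ≤ q) (a : (QuotMod q)ˣ) : ∃ γ : 𝓞 K, γ ≠ 0 ∧ toQuotMod q γ = a := by
  obtain ⟨γ, hγ⟩ := Ideal.Quotient.mk_surjective (a : QuotMod q)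
  by_cases h0 : γ = 0
  · refine ⟨((q : ℕ) : 𝓞 K), by exact_mod_cast (Nat.one_le_iff_ne_zero.mp hq), ?_⟩
    rw [Ideal.Quotient.eq_zero_iff_mem.mpr (Ideal.mem_span_singleton_self _), ← hγ, h0, map_zero]
  · exact ⟨γ, h0, hγ⟩

/-- **Step 5 and conclusion — Heath-Brown's characterisation of the trivial characters** (p. 54: "This
corresponds to having the trivial character `χ` modulo `q`, letting `s = t = 0` in the definition of `ν₀`,
and taking `j = k = 0`"): if `ν^{(j,k)}` takes the value `1` at every non-zero ideal coprime to `q`, then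
`χ = χ₀`, `j = 0` and `k = 0` (and `s = t = 0`, `charSign_eq_zero_of_isTrivialMod`,
`charAngle_eq_zero_of_isTrivialMod`). [cite: HeathBrownActa2001, §9 p. 54] -/
theorem eq_one_of_isTrivialMod (hq : 1 ≤ q) {χ : MulChar (QuotMod q) ℂ} {j k : ℤ}
    (h : IsTrivialMod q (grossenChar hq χ j k)) : χ = 1 ∧ j = 0 ∧ k = 0 := by
  have hj := eq_zero_of_isTrivialMod_j hq h
  have hk := eq_zero_of_isTrivialMod_k hq h
  have ht := charAngle_eq_zero_of_isTrivialMod hq h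
  have hs := charSign_eq_zero_of_isTrivialMod hq h
  refine ⟨?_, hj, hk⟩
  subst hj; subst hk
  apply MulChar.ext
  intro a
  rw [MulChar.one_apply_coe]
  obtain ⟨γ, hγ0, hγ⟩ := exists_ne_zero_toQuotMod_eq hq a
  have h1 := nuO_eq_one_of_isTrivialMod hq h hγ0 (by rw [hγ]; exact Units.isUnit a)
  rw [zpow_zero, zpow_zero, mul_one, mul_one, nu0O, hs, ht, pow_zero, mul_one, zero_mul, neg_zero,
    Complex.ofReal_zero, zero_mul, Complex.exp_zero, mul_one, hγ] at h1
  exact h1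

/-- **Trivial ⟺ (`χ = χ₀`, `j = k = 0`).** [cite: HeathBrownActa2001, §9 p. 54] -/
theorem isTrivialMod_iff (hq : 1 ≤ q) {χ : MulChar (QuotMod q) ℂ} {j k : ℤ} :
    IsTrivialMod q (grossenChar hq χ j k) ↔ χ = 1 ∧ j = 0 ∧ k = 0 := by
  refine ⟨eq_one_of_isTrivialMod hq, ?_⟩
  rintro ⟨rfl, rfl, rfl⟩
  exact isTrivialMod_grossenChar_one hq

end Literature.NumberTheory.Sieve.CubicSieve
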